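import Literature.MathematicalPhysics.KineticTheory.LangevinChainGibbs
import Literature.MathematicalPhysics.KineticTheory.LangevinChainNESSProofs
import Literature.Barriers.AtomisticToContinuum.FPUBetaKineticAnomalyUnpinned
import Mathlib.Data.Fin.Tuple.Take
import HarnessLib

/-!
# Peeling the last site off the Gibbs weight of an oscillator chain (transfer recursion)

Helper file (`--supports stmt-AtomisticToContinuum-12240`, item `HalfChainLocality` of route
`BoundaryEscapeDeficit`, sub-problem `FouriersLaw`). For a nearest-neighbour chain
`P : OscillatorChain` with measurable potentials and any `T`, write `W_N = e^{-H_N/T}` for the Gibbs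
weight on `PhaseSpace N = (Fin N → ℝ) × (Fin N → ℝ)`, `w(q, p) = e^{-(p²/2 + U(q))/T}` for the one-site
weight on `ℝ × ℝ`, `ρ = w · Lebesgue` for the one-site a priori measure and
`k((q,p), (q',p')) = e^{-V(q' - q)/T}` for the bond transfer kernel. This file proves the transfer
recursion of the finite-volume Gibbs weights in the form needed for the boundary marginals of the
open chain (window at the LEFT end, sites peeled off the RIGHT end):

* `lintegral_fin_succ_eq_snoc`, `lintegral_phaseSpace_succ` — Lebesgue integrals over
  `Fin (n+1) → ℝ` / `PhaseSpace (n+1)` as iterated integrals over the first `n` sites and the last one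
  (`MeasureTheory.volume_preserving_piFinSuccAbove` at `Fin.last n` + Tonelli);
* `hamiltonian_snoc_succ` — `H_{n+2}(q :: a, p :: b) = H_{n+1}(q, p) + (b²/2 + U(a)) + V(a - q_n)`;
* `lintegral_init_mul_last_mul_gibbsWeight` — ONE-STEP PEELING:
  `∫ F(init x) h(x_{n+1}) W_{n+2}(x) dx = ∫ F(y) W_{n+1}(y) (κ h)(y_n) dy`,
  `(κ h)(z) = ∫ k(z, z') h(z') dρ(z')`;
* `lintegral_take_mul_last_mul_gibbsWeight` — ITERATED PEELING: for `ℓ ≤ n`,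
  `∫ F(take_{ℓ+1} x) h(x_n) W_{n+1}(x) dx = ∫ F(y) W_{ℓ+1}(y) (κ^[n-ℓ] h)(y_ℓ) dy`.

Everything is an identity of `ℝ≥0∞`-valued Lebesgue integrals (no integrability side conditions) and
is tagged folklore (transfer-operator form of one-dimensional Gibbs weights, Georgii 2011 §11.1). No
definitions: the weights, `ρ`, `k` and `κ` are written out.
-/

noncomputable section

open MeasureTheory Set Function
open scoped ENNReal

namespace Summit.AtomisticToContinuum.FouriersLaw.Theorems.HalfChainLocality

open Literature.MathematicalPhysics.KineticTheory.HeatConduction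

/-! ### Splitting off the last coordinate of `Fin (n+1) → ℝ` and of `PhaseSpace (n+1)` -/

/-- `(q, a) ↦ q :: a` (`Fin.snoc`) is measurable: it is the inverse of the measurable equivalence
`MeasurableEquiv.piFinSuccAbove _ (Fin.last n)` up to swapping the factors. [folklore] -/
theorem measurable_finSnoc (n : ℕ) :
    Measurable fun x : (Fin n → ℝ) × ℝ => (Fin.snoc x.1 x.2 : Fin (n + 1) → ℝ) := by
  have h : (fun x : (Fin n → ℝ) × ℝ => (Fin.snoc x.1 x.2 : Fin (n + 1) → ℝ)) =
      (MeasurableEquiv.piFinSuccAbove (fun _ : Fin (n + 1) => ℝ) (Fin.last n)).symm ∘ Prod.swap := by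
    funext x
    simp [MeasurableEquiv.piFinSuccAbove_symm_apply, Fin.insertNthEquiv, Fin.insertNth_last']
  rw [h]
  exact (MeasurableEquiv.measurable _).comp measurable_swap

/-- Compositional form of `measurable_finSnoc` for `fun_prop`. [folklore] -/
@[fun_prop]
theorem Measurable.finSnoc {α : Type*} [MeasurableSpace α] (n : ℕ) {f : α → (Fin n → ℝ)}
    {g : α → ℝ} (hf : Measurable f) (hg : Measurable g) :
    Measurable fun x => (Fin.snoc (f x) (g x) : Fin (n + 1) → ℝ) :=
  (measurable_finSnoc n).comp (hf.prodMk hg)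

/-- Integrating out the last coordinate: Lebesgue measure on `Fin (n+1) → ℝ` is the product of
Lebesgue measure on the first `n` coordinates and on the last one (Tonelli). [folklore] -/
theorem lintegral_fin_succ_eq_snoc (n : ℕ) {F : (Fin (n + 1) → ℝ) → ℝ≥0∞} (hF : Measurable F) :
    ∫⁻ q, F q = ∫⁻ q : Fin n → ℝ, ∫⁻ a : ℝ, F (Fin.snoc q a) := by
  have hmp := (volume_preserving_piFinSuccAbove (fun _ : Fin (n + 1) => ℝ) (Fin.last n)).symm
  rw [← hmp.lintegral_comp_emb (MeasurableEquiv.measurableEmbedding _),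
    Measure.volume_eq_prod, lintegral_prod]
  · have h1 : ∀ (a : ℝ) (q : Fin n → ℝ),
        F ((MeasurableEquiv.piFinSuccAbove (fun _ : Fin (n + 1) => ℝ) (Fin.last n)).symm (a, q)) =
          F (Fin.snoc q a) := by
      intro a q
      simp [MeasurableEquiv.piFinSuccAbove_symm_apply, Fin.insertNthEquiv, Fin.insertNth_last']
    simp_rw [h1]
    exact lintegral_lintegral_swap ((hF.comp (measurable_finSnoc n)).comp measurable_swap).aemeasurable
  · exact (hF.comp (MeasurableEquiv.measurable _)).aemeasurable

/-- Integrating out the last SITE of phase space: `∫ F dx` over `PhaseSpace (n+1)` is the iterated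
integral over the first `n` sites `y` and the last site `z = (q_n, p_n) ∈ ℝ × ℝ` of
`F(y.1 :: z.1, y.2 :: z.2)`. [folklore] -/
theorem lintegral_phaseSpace_succ (n : ℕ) {F : PhaseSpace (n + 1) → ℝ≥0∞} (hF : Measurable F) :
    ∫⁻ x, F x = ∫⁻ y : PhaseSpace n, ∫⁻ z : ℝ × ℝ,
      F ((Fin.snoc y.1 z.1 : Fin (n + 1) → ℝ), (Fin.snoc y.2 z.2 : Fin (n + 1) → ℝ)) := by
  -- the integrand in the four variables `((q', p'), (a, b))`
  have hG : Measurable fun v : PhaseSpace n × (ℝ × ℝ) =>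
      F ((Fin.snoc v.1.1 v.2.1 : Fin (n + 1) → ℝ), (Fin.snoc v.1.2 v.2.2 : Fin (n + 1) → ℝ)) := by
    refine hF.comp ?_
    exact ((measurable_finSnoc n).comp (measurable_fst.fst.prodMk measurable_snd.fst)).prodMk
      ((measurable_finSnoc n).comp (measurable_fst.snd.prodMk measurable_snd.snd))
  -- product structure of Lebesgue measure on `PhaseSpace m` and on `ℝ × ℝ` (definitional)
  have hPS : ∀ (m : ℕ) (Φ : PhaseSpace m → ℝ≥0∞), Measurable Φ →
      ∫⁻ y, Φ y = ∫⁻ q : Fin m → ℝ, ∫⁻ p : Fin m → ℝ, Φ (q, p) := fun m Φ hΦ =>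
    lintegral_prod (μ := (volume : Measure (Fin m → ℝ))) (ν := (volume : Measure (Fin m → ℝ))) Φ
      hΦ.aemeasurable
  have hRR : ∀ (Φ : ℝ × ℝ → ℝ≥0∞), Measurable Φ → ∫⁻ z, Φ z = ∫⁻ a : ℝ, ∫⁻ b : ℝ, Φ (a, b) :=
    fun Φ hΦ => lintegral_prod (μ := (volume : Measure ℝ)) (ν := (volume : Measure ℝ)) Φ hΦ.aemeasurable
  -- left-hand side: `∫ dq' ∫ da ∫ dp' ∫ db`
  rw [hPS (n + 1) F hF]
  have h1 : ∀ q : Fin (n + 1) → ℝ, ∫⁻ p : Fin (n + 1) → ℝ, F (q, p) =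
      ∫⁻ p : Fin n → ℝ, ∫⁻ b : ℝ, F (q, Fin.snoc p b) := fun q =>
    lintegral_fin_succ_eq_snoc n (hF.comp (measurable_const.prodMk measurable_id))
  simp_rw [h1]
  have hm3 : Measurable fun v : (Fin (n + 1) → ℝ) × (Fin n → ℝ) => ∫⁻ b : ℝ, F (v.1, Fin.snoc v.2 b) := by
    refine Measurable.lintegral_prod_right'
      (f := fun w : ((Fin (n + 1) → ℝ) × (Fin n → ℝ)) × ℝ => F (w.1.1, Fin.snoc w.1.2 w.2)) ?_
    refine hF.comp (measurable_fst.fst.prodMk ?_)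
    exact (measurable_finSnoc n).comp (measurable_fst.snd.prodMk measurable_snd)
  have hm2 : Measurable fun q : Fin (n + 1) → ℝ => ∫⁻ p : Fin n → ℝ, ∫⁻ b : ℝ, F (q, Fin.snoc p b) :=
    Measurable.lintegral_prod_right'
      (f := fun v : (Fin (n + 1) → ℝ) × (Fin n → ℝ) => ∫⁻ b : ℝ, F (v.1, Fin.snoc v.2 b)) hm3
  rw [lintegral_fin_succ_eq_snoc n hm2]
  -- right-hand side: `∫ dq' ∫ dp' ∫ da ∫ db`
  rw [hPS n _ (Measurable.lintegral_prod_right' hG)]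
  refine lintegral_congr fun q => ?_
  have h2 : ∀ p : Fin n → ℝ, ∫⁻ z : ℝ × ℝ,
      F ((Fin.snoc q z.1 : Fin (n + 1) → ℝ), (Fin.snoc p z.2 : Fin (n + 1) → ℝ)) =
      ∫⁻ a : ℝ, ∫⁻ b : ℝ, F (Fin.snoc q a, Fin.snoc p b) := fun p =>
    hRR _ (hG.comp ((measurable_const (a := ((q, p) : PhaseSpace n))).prodMk measurable_id))
  simp_rw [h2]
  -- swap `∫ da` and `∫ dp'`
  have hm4 : Measurable fun w : (ℝ × (Fin n → ℝ)) × ℝ =>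
      F ((Fin.snoc q w.1.1 : Fin (n + 1) → ℝ), (Fin.snoc w.1.2 w.2 : Fin (n + 1) → ℝ)) := by
    refine hF.comp ?_
    exact ((measurable_finSnoc n).comp (measurable_const.prodMk measurable_fst.fst)).prodMk
      ((measurable_finSnoc n).comp (measurable_fst.snd.prodMk measurable_snd))
  exact lintegral_lintegral_swap (f := fun (a : ℝ) (p : Fin n → ℝ) => ∫⁻ b : ℝ, F (Fin.snoc q a, Fin.snoc p b))
    (Measurable.lintegral_prod_right'
      (f := fun w : (ℝ × (Fin n → ℝ)) × ℝ => F (Fin.snoc q w.1.1, Fin.snoc w.1.2 w.2)) hm4).aemeasurable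

/-! ### The Hamiltonian along the transfer recursion -/

section Hamiltonian

variable (P : OscillatorChain)

/-- The bond sum of a configuration `q :: a` of `n+2` sites: the bonds of `q` plus the new bond
`V(a - q_n)`. [folklore] -/
theorem bondSum_snoc_succ (n : ℕ) (q : Fin (n + 1) → ℝ) (a : ℝ) :
    (∑ i : Fin (n + 2), ∑ j : Fin (n + 2),
        if j.val = i.val + 1 then P.V ((Fin.snoc q a : Fin (n + 2) → ℝ) j - (Fin.snoc q a : Fin (n + 2) → ℝ) i)
        else 0) =
      (∑ i : Fin (n + 1), ∑ j : Fin (n + 1), if j.val = i.val + 1 then P.V (q j - q i) else 0) +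
        P.V (a - q (Fin.last n)) := by
  rw [Fin.sum_univ_castSucc]
  -- the last site starts no bond
  have hlast : (∑ j : Fin (n + 2), if j.val = (Fin.last (n + 1)).val + 1 then
      P.V ((Fin.snoc q a : Fin (n + 2) → ℝ) j - (Fin.snoc q a : Fin (n + 2) → ℝ) (Fin.last (n + 1)))
      else 0) = 0 := by
    refine Finset.sum_eq_zero fun j _ => ?_
    rw [if_neg]
    have := j.isLt
    simp only [Fin.val_last]
    omega
  rw [hlast, add_zero]
  -- bonds starting at an old site
  have hold : ∀ i : Fin (n + 1), (∑ j : Fin (n + 2), if j.val = (Fin.castSucc i).val + 1 then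
      P.V ((Fin.snoc q a : Fin (n + 2) → ℝ) j - (Fin.snoc q a : Fin (n + 2) → ℝ) (Fin.castSucc i))
      else 0) =
      (∑ j : Fin (n + 1), if j.val = i.val + 1 then P.V (q j - q i) else 0) +
        (if n = i.val then P.V (a - q i) else 0) := by
    intro i
    rw [Fin.sum_univ_castSucc]
    simp only [Fin.val_castSucc, Fin.snoc_castSucc, Fin.val_last, Fin.snoc_last]
    congr 1
    by_cases h : n = i.val
    · rw [if_pos (by omega), if_pos h]
    · rw [if_neg (by omega), if_neg h]
  rw [Finset.sum_congr rfl fun i _ => hold i, Finset.sum_add_distrib]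
  congr 1
  rw [Finset.sum_eq_single (Fin.last n)]
  · simp
  · intro b _ hb
    rw [if_neg]
    intro h
    exact hb (Fin.ext (by simp [Fin.val_last]; omega))
  · intro h
    exact absurd (Finset.mem_univ _) h

/-- **Transfer recursion of the Hamiltonian**: adding a site `(a, b)` at the right end of an
`(n+1)`-site chain, `H_{n+2}(q :: a, p :: b) = H_{n+1}(q, p) + (b²/2 + U(a)) + V(a - q_n)`.
[folklore] -/
theorem hamiltonian_snoc_succ (n : ℕ) (q p : Fin (n + 1) → ℝ) (a b : ℝ) :
    P.hamiltonian (n + 2) ((Fin.snoc q a : Fin (n + 2) → ℝ), (Fin.snoc p b : Fin (n + 2) → ℝ)) =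
      P.hamiltonian (n + 1) (q, p) + (b ^ 2 / 2 + P.U a) + P.V (a - q (Fin.last n)) := by
  simp only [OscillatorChain.hamiltonian]
  rw [bondSum_snoc_succ P n q a, Fin.sum_univ_castSucc]
  simp only [Fin.snoc_castSucc, Fin.snoc_last]
  ring

/-- The Gibbs weight factorises along the transfer recursion:
`e^{-H_{n+2}(q::a, p::b)/T} = e^{-H_{n+1}(q,p)/T} · e^{-V(a - q_n)/T} · e^{-(b²/2+U(a))/T}`. [folklore] -/
theorem ofReal_gibbsDensity_snoc_succ (n : ℕ) (T : ℝ) (q p : Fin (n + 1) → ℝ) (a b : ℝ) :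
    ENNReal.ofReal (P.gibbsDensity (n + 2) T
        ((Fin.snoc q a : Fin (n + 2) → ℝ), (Fin.snoc p b : Fin (n + 2) → ℝ))) =
      ENNReal.ofReal (P.gibbsDensity (n + 1) T (q, p)) *
        (ENNReal.ofReal (Real.exp (-P.V (a - q (Fin.last n)) / T)) *
          ENNReal.ofReal (Real.exp (-(b ^ 2 / 2 + P.U a) / T))) := by
  simp only [OscillatorChain.gibbsDensity]
  rw [hamiltonian_snoc_succ P, ← ENNReal.ofReal_mul (Real.exp_nonneg _),
    ← ENNReal.ofReal_mul (Real.exp_nonneg _), ← Real.exp_add, ← Real.exp_add]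
  congr 2
  ring

end Hamiltonian

/-! ### Peeling identities -/

section Peel

variable (P : OscillatorChain) (hU : Measurable P.U) (hV : Measurable P.V) (T : ℝ)
include hU hV

/-- Measurability of the `ℝ≥0∞`-valued Gibbs weight `e^{-H_N/T}`. [folklore] -/
theorem measurable_ofReal_gibbsDensity (N : ℕ) :
    Measurable fun x : PhaseSpace N => ENNReal.ofReal (P.gibbsDensity N T x) := by
  have hH : Measurable (P.hamiltonian N) := by
    unfold OscillatorChain.hamiltonian
    refine Measurable.add ?_ ?_
    · refine Finset.measurable_sum _ fun i _ => ?_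
      exact (((measurable_pi_apply i).comp measurable_snd).pow_const 2).div_const 2 |>.add
        (hU.comp ((measurable_pi_apply i).comp measurable_fst))
    · refine Finset.measurable_sum _ fun i _ => Finset.measurable_sum _ fun j _ => ?_
      by_cases h : j.val = i.val + 1
      · simp only [h, if_true]
        exact hV.comp (((measurable_pi_apply j).comp measurable_fst).sub
          ((measurable_pi_apply i).comp measurable_fst))
      · simp only [h, if_false]
        exact measurable_const
  unfold OscillatorChain.gibbsDensity
  exact ((hH.neg.div_const T).exp).ennreal_ofReal

omit hV in
/-- Measurability of the one-site weight `w(q,p) = e^{-(p²/2 + U(q))/T}` on `ℝ × ℝ`. [folklore] -/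
theorem measurable_siteWeight :
    Measurable fun z : ℝ × ℝ => ENNReal.ofReal (Real.exp (-(z.2 ^ 2 / 2 + P.U z.1) / T)) :=
  (((measurable_snd.pow_const 2).div_const 2 |>.add (hU.comp measurable_fst)).neg.div_const T).exp
    |>.ennreal_ofReal

omit hU in
/-- Joint measurability of the bond transfer kernel `k(z, z') = e^{-V(z'.1 - z.1)/T}`. [folklore] -/
theorem measurable_bondKernel_uncurry :
    Measurable fun v : (ℝ × ℝ) × (ℝ × ℝ) => ENNReal.ofReal (Real.exp (-P.V (v.2.1 - v.1.1) / T)) :=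
  (((hV.comp (measurable_snd.fst.sub measurable_fst.fst)).neg.div_const T).exp).ennreal_ofReal

omit hV in
/-- Integration against the one-site a priori measure `ρ = w · Lebesgue` is integration of `g · w`
against Lebesgue measure. [folklore] -/
theorem lintegral_siteMeasure_eq {g : ℝ × ℝ → ℝ≥0∞} (hg : Measurable g) :
    ∫⁻ z, g z ∂(volume.withDensity fun z : ℝ × ℝ => ENNReal.ofReal (Real.exp (-(z.2 ^ 2 / 2 + P.U z.1) / T))) =
      ∫⁻ z : ℝ × ℝ, g z * ENNReal.ofReal (Real.exp (-(z.2 ^ 2 / 2 + P.U z.1) / T)) := by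
  rw [lintegral_withDensity_eq_lintegral_mul _ (measurable_siteWeight P hU T) hg]
  exact lintegral_congr fun z => by rw [Pi.mul_apply, mul_comm]

omit hU in
/-- The lintegral transfer step `(κ h)(z) = ∫ k(z,z') h(z') dρ(z')` preserves measurability.
[folklore] -/
theorem measurable_transferStep {h : ℝ × ℝ → ℝ≥0∞} (hh : Measurable h) :
    Measurable fun z : ℝ × ℝ => ∫⁻ z', ENNReal.ofReal (Real.exp (-P.V (z'.1 - z.1) / T)) * h z'
      ∂(volume.withDensity fun z' : ℝ × ℝ => ENNReal.ofReal (Real.exp (-(z'.2 ^ 2 / 2 + P.U z'.1) / T))) :=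
  Measurable.lintegral_prod_right' ((measurable_bondKernel_uncurry P hV T).mul (hh.comp measurable_snd))

omit hU in
/-- Iterates of the lintegral transfer step preserve measurability. [folklore] -/
theorem measurable_transferStep_iterate {h : ℝ × ℝ → ℝ≥0∞} (hh : Measurable h) (m : ℕ) :
    Measurable ((fun g : ℝ × ℝ → ℝ≥0∞ => fun z : ℝ × ℝ =>
      ∫⁻ z', ENNReal.ofReal (Real.exp (-P.V (z'.1 - z.1) / T)) * g z'
        ∂(volume.withDensity fun z' : ℝ × ℝ =>
          ENNReal.ofReal (Real.exp (-(z'.2 ^ 2 / 2 + P.U z'.1) / T))))^[m] h) := by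
  induction m with
  | zero => exact hh
  | succ m ih =>
    rw [Function.iterate_succ_apply']
    exact measurable_transferStep P hV T ih

/-- **One-step peeling of the Gibbs weight.** For measurable `F ≥ 0` on the first `n+1` sites and
`h ≥ 0` on the last site,
`∫ F(init x) h(x_{n+1}) e^{-H_{n+2}(x)/T} dx = ∫ F(y) e^{-H_{n+1}(y)/T} (κ h)(y_n) dy` with
`(κ h)(z) = ∫ e^{-V(z'.1 - z.1)/T} h(z') dρ(z')`, `ρ = e^{-(p²/2+U(q))/T} dq dp`. [folklore] -/
theorem lintegral_init_mul_last_mul_gibbsWeight (n : ℕ) {F : PhaseSpace (n + 1) → ℝ≥0∞}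
    (hF : Measurable F) {h : ℝ × ℝ → ℝ≥0∞} (hh : Measurable h) :
    ∫⁻ x : PhaseSpace (n + 2), F (Fin.init x.1, Fin.init x.2) *
        h (x.1 (Fin.last (n + 1)), x.2 (Fin.last (n + 1))) * ENNReal.ofReal (P.gibbsDensity (n + 2) T x) =
      ∫⁻ y : PhaseSpace (n + 1), F y *
        (fun z : ℝ × ℝ => ∫⁻ z', ENNReal.ofReal (Real.exp (-P.V (z'.1 - z.1) / T)) * h z'
          ∂(volume.withDensity fun z' : ℝ × ℝ =>
            ENNReal.ofReal (Real.exp (-(z'.2 ^ 2 / 2 + P.U z'.1) / T)))) (y.1 (Fin.last n), y.2 (Fin.last n)) *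
        ENNReal.ofReal (P.gibbsDensity (n + 1) T y) := by
  have hm : Measurable fun x : PhaseSpace (n + 2) => F (Fin.init x.1, Fin.init x.2) *
      h (x.1 (Fin.last (n + 1)), x.2 (Fin.last (n + 1))) * ENNReal.ofReal (P.gibbsDensity (n + 2) T x) := by
    refine ((hF.comp ?_).mul (hh.comp ?_)).mul (measurable_ofReal_gibbsDensity P hU hV T (n + 2))
    · exact (measurable_pi_lambda _ fun i => (measurable_pi_apply _).comp measurable_fst).prodMk
        (measurable_pi_lambda _ fun i => (measurable_pi_apply _).comp measurable_snd)
    · exact ((measurable_pi_apply _).comp measurable_fst).prodMk ((measurable_pi_apply _).comp measurable_snd)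
  rw [lintegral_phaseSpace_succ (n + 1) hm]
  refine lintegral_congr fun y => ?_
  dsimp only
  simp only [Fin.init_snoc, Fin.snoc_last, Prod.mk.eta]
  have e : ∀ z : ℝ × ℝ, ENNReal.ofReal (P.gibbsDensity (n + 2) T
      ((Fin.snoc y.1 z.1 : Fin (n + 2) → ℝ), (Fin.snoc y.2 z.2 : Fin (n + 2) → ℝ))) =
      ENNReal.ofReal (P.gibbsDensity (n + 1) T y) *
        (ENNReal.ofReal (Real.exp (-P.V (z.1 - y.1 (Fin.last n)) / T)) *
          ENNReal.ofReal (Real.exp (-(z.2 ^ 2 / 2 + P.U z.1) / T))) := fun z =>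
    ofReal_gibbsDensity_snoc_succ P n T y.1 y.2 z.1 z.2
  simp_rw [e]
  have hk : Measurable fun z' : ℝ × ℝ => ENNReal.ofReal (Real.exp (-P.V (z'.1 - y.1 (Fin.last n)) / T)) :=
    (((hV.comp (measurable_fst.sub measurable_const)).neg.div_const T).exp).ennreal_ofReal
  have hkh : Measurable fun z' : ℝ × ℝ =>
      ENNReal.ofReal (Real.exp (-P.V (z'.1 - y.1 (Fin.last n)) / T)) * h z' := hk.mul hh
  have hkhw : Measurable fun z' : ℝ × ℝ =>
      ENNReal.ofReal (Real.exp (-P.V (z'.1 - y.1 (Fin.last n)) / T)) * h z' *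
        ENNReal.ofReal (Real.exp (-(z'.2 ^ 2 / 2 + P.U z'.1) / T)) := hkh.mul (measurable_siteWeight P hU T)
  rw [lintegral_siteMeasure_eq P hU T hkh, ← lintegral_const_mul (F y) hkhw,
    ← lintegral_mul_const _ (hkhw.const_mul _)]
  refine lintegral_congr fun z => ?_
  ring

/-- **Iterated peeling of the Gibbs weight (transfer-operator form of the boundary marginal).** For
`ℓ ≤ n`, measurable `F ≥ 0` on the first `ℓ+1` sites and `h ≥ 0` on the last site of the
`(n+1)`-chain, `∫ F(take_{ℓ+1} x) h(x_n) e^{-H_{n+1}(x)/T} dx = ∫ F(y) e^{-H_{ℓ+1}(y)/T} (κ^[n-ℓ] h)(y_ℓ) dy`.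
[folklore] -/
theorem lintegral_take_mul_last_mul_gibbsWeight :
    ∀ (n ℓ : ℕ) (hℓ : ℓ ≤ n) {F : PhaseSpace (ℓ + 1) → ℝ≥0∞}, Measurable F →
      ∀ {h : ℝ × ℝ → ℝ≥0∞}, Measurable h →
      ∫⁻ x : PhaseSpace (n + 1),
          F (Fin.take (ℓ + 1) (Nat.succ_le_succ hℓ) x.1, Fin.take (ℓ + 1) (Nat.succ_le_succ hℓ) x.2) *
            h (x.1 (Fin.last n), x.2 (Fin.last n)) * ENNReal.ofReal (P.gibbsDensity (n + 1) T x) =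
        ∫⁻ y : PhaseSpace (ℓ + 1), F y *
          ((fun g : ℝ × ℝ → ℝ≥0∞ => fun z : ℝ × ℝ =>
            ∫⁻ z', ENNReal.ofReal (Real.exp (-P.V (z'.1 - z.1) / T)) * g z'
              ∂(volume.withDensity fun z' : ℝ × ℝ =>
                ENNReal.ofReal (Real.exp (-(z'.2 ^ 2 / 2 + P.U z'.1) / T))))^[n - ℓ] h)
            (y.1 (Fin.last ℓ), y.2 (Fin.last ℓ)) * ENNReal.ofReal (P.gibbsDensity (ℓ + 1) T y) := by
  intro n
  induction n with
  | zero =>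
    intro ℓ hℓ F hF h hh
    obtain rfl : ℓ = 0 := Nat.le_zero.1 hℓ
    simp only [Nat.sub_self, Function.iterate_zero, id_eq, Fin.take_eq_self]
  | succ n ih =>
    intro ℓ hℓ F hF h hh
    rcases Nat.lt_or_ge n ℓ with hlt | hle
    · -- `ℓ = n + 1`: nothing to peel
      obtain rfl : ℓ = n + 1 := le_antisymm hℓ hlt
      simp only [Nat.sub_self, Function.iterate_zero, id_eq, Fin.take_eq_self]
    · -- `ℓ ≤ n`: peel the last site, then induct
      have htake : ∀ x : PhaseSpace (n + 2),
          (Fin.take (ℓ + 1) (Nat.succ_le_succ hℓ) x.1, Fin.take (ℓ + 1) (Nat.succ_le_succ hℓ) x.2) =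
            (Fin.take (ℓ + 1) (Nat.succ_le_succ hle) (Fin.init x.1),
              Fin.take (ℓ + 1) (Nat.succ_le_succ hle) (Fin.init x.2)) := fun x => rfl
      simp_rw [htake]
      have hF' : Measurable fun y : PhaseSpace (n + 1) =>
          F (Fin.take (ℓ + 1) (Nat.succ_le_succ hle) y.1, Fin.take (ℓ + 1) (Nat.succ_le_succ hle) y.2) := by
        refine hF.comp ?_
        exact (measurable_pi_lambda _ fun i => (measurable_pi_apply _).comp measurable_fst).prodMk
          (measurable_pi_lambda _ fun i => (measurable_pi_apply _).comp measurable_snd)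
      have key := lintegral_init_mul_last_mul_gibbsWeight P hU hV T n hF' hh
      dsimp only at key
      rw [key, ih ℓ hle hF (measurable_transferStep P hV T hh), Nat.succ_sub hle,
        Function.iterate_succ_apply]

end Peel

end Summit.AtomisticToContinuum.FouriersLaw.Theorems.HalfChainLocality

end
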